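import Literature.NumberTheory.Sieve.FGKMT2018SingularSeriesExcl
import Literature.NumberTheory.Sieve.FGKMT2018Section8Scalars
import Literature.NumberTheory.Sieve.Maynard2016IntervalPrimes
import Literature.NumberTheory.Multiplicative.SigmaTotientExtremalOrders
import HarnessLib

/-!
# FGKMT 2018 §8 — toolbox for «Theorem 6 ⟹ Theorem 5»: counting, windows, comparison of weights

Fourth support file for the edge «Theorem 6 ⟹ Theorem 5» of Ford–Green–Konyagin–Maynard–Tao,
*Long gaps between primes* (§8, arXiv:1412.5029v4 pp. 22–24). It collects the elementary facts the
deduction uses besides the structure of the weights (`FGKMT2018SieveWeightsStructure`,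
`FGKMT2018SingularSeriesExcl`) and the scalars (`FGKMT2018Section8Scalars`):

* error bookkeeping (`abs_sub_le_chain`, `abs_sub_le_chain₂`, `abs_sum_mul_sub_sum_le`,
  `abs_div_sq_sub_one_le`, `inv_log_rpow_le`);
* the dyadic blocks `𝒜(X) = dyadZ X`: membership, `X − 1 ≤ #𝒜(X) ≤ X + 1`, `𝒜(2N) = [2N, 4N]`,
  the translation of a window sum (`sum_Icc_sieveWt_eq_sum_shift`), and the identification of the
  primes of `𝒜(x/2 + 1/4)` with `𝒫 = primesHalf x` (`dyadZ_filter_prime_eq_map`);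
* the prime number theorem for `#𝒫`: `#𝒫 = (1 + O(1/log x)) x/(2 log x)` (`card_primesHalf_asymp`,
  from the tree's PROVED `ϑ(x) = x + O(x/log² x)`);
* primes `> 2k²` are coprime to `W` (`int_gcd_wCut_eq_one`), small divisors of primes;
* the correction factors `𝔖_D(𝓛_p) = ρ 𝔖_D(𝓛_1)`, `𝔖_D(L̃_{q,i}) = ρ 𝔖_D(𝓛_1)` with `ρ ∈ [1, 1+2k/p]`
  (`singSeriesExcl_tupleForms_ratio`, `singSeriesExcl_wbpForms_ratio`);
* the comparison principle of the proof of (6.4) in its final form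
  `w_{𝓛_p}(q − h_i p) = (𝔖_{WB}(𝓛_p)/𝔖_{WB}(L̃_{q,i}))² · w_{L̃_{q,i}}(p)` (`sieveWt_tupleForms_eq_sq_mul`);
* the growth facts of the regime `x → ∞` (`section8_growth`).

## References
* K. Ford, B. Green, S. Konyagin, J. Maynard, T. Tao, *Long gaps between primes*, J. Amer. Math.
  Soc. 31 (2018) 65–105, §8 (arXiv:1412.5029v4 pp. 22–24) [FordGreenKonyaginMaynardTao2018].
* H. L. Montgomery, R. C. Vaughan, *Multiplicative Number Theory I*, Thm 6.9 (PNT with error term).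
-/

open Finset Filter Topology

namespace Literature.NumberTheory.Sieve.FGKMT2018

variable {k : ℕ}

/-! ### Elementary error bookkeeping -/

/-- `|∑ λᵢ gᵢ − ∑ gᵢ| ≤ η ∑ gᵢ` when `gᵢ ≥ 0` and `|λᵢ − 1| ≤ η`.
[cite: FordGreenKonyaginMaynardTao2018, §8 proof of (6.4) («w(p, q − h_i p) = (1 + O(k/x)) w̃»)] -/
theorem abs_sum_mul_sub_sum_le {ι : Type*} (s : Finset ι) {f g : ι → ℝ} {η : ℝ}
    (hg : ∀ i ∈ s, 0 ≤ g i) (hf : ∀ i ∈ s, |f i - 1| ≤ η) :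
    |∑ i ∈ s, f i * g i - ∑ i ∈ s, g i| ≤ η * ∑ i ∈ s, g i := by
  rw [← Finset.sum_sub_distrib, Finset.mul_sum]
  refine (Finset.abs_sum_le_sum_abs _ _).trans (Finset.sum_le_sum fun i hi => ?_)
  rw [show f i * g i - g i = (f i - 1) * g i by ring, abs_mul, abs_of_nonneg (hg i hi)]
  exact mul_le_mul_of_nonneg_right (hf i hi) (hg i hi)

/-- Three-step error chain: `|S' − M| ≤ aM + fT`, `M = mT` with `|m − 1| ≤ d`, `|S − S'| ≤ g S'`
(`T ≥ 0`, `a, d, f ≤ 1`) give `|S − T| ≤ (5g + 2a + f + d) T`.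
[cite: FordGreenKonyaginMaynardTao2018, §8 p. 23 (combination of the relative errors)] -/
theorem abs_sub_le_chain {S S' M T m a d f g : ℝ} (hT : 0 ≤ T) (hM : M = m * T)
    (hm : |m - 1| ≤ d) (hd1 : d ≤ 1) (hS' : |S' - M| ≤ a * M + f * T) (ha : 0 ≤ a) (ha1 : a ≤ 1)
    (hf1 : f ≤ 1) (hS : |S - S'| ≤ g * S') (hg : 0 ≤ g) :
    |S - T| ≤ (5 * g + 2 * a + f + d) * T := by
  have hm' := abs_le.mp hm
  have hm0 : 0 ≤ m := by linarith
  have hm2 : m ≤ 2 := by linarith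
  have hM0 : 0 ≤ M := by rw [hM]; positivity
  have hM2 : M ≤ 2 * T := by rw [hM]; nlinarith
  have hMT : |M - T| ≤ d * T := by
    rw [hM, show m * T - T = (m - 1) * T by ring, abs_mul, abs_of_nonneg hT]
    exact mul_le_mul_of_nonneg_right hm hT
  have hS'5 : S' ≤ 5 * T := by
    have h1 := (abs_le.mp hS').2
    have h2 : a * M ≤ M := by nlinarith
    have h3 : f * T ≤ T := by nlinarith
    linarith
  have hgS : g * S' ≤ 5 * g * T := by nlinarith
  have haM : a * M ≤ 2 * a * T := by nlinarith
  calc |S - T| = |(S - S') + (S' - M) + (M - T)| := by ring_nf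
    _ ≤ |S - S'| + |S' - M| + |M - T| := abs_add_three _ _ _
    _ ≤ g * S' + (a * M + f * T) + d * T := add_le_add (add_le_add hS hS') hMT
    _ ≤ (5 * g + 2 * a + f + d) * T := by linarith

/-- Two-step error chain: `|S − M| ≤ aM`, `M = mT`, `|m − 1| ≤ d ≤ 1`, `T ≥ 0` give
`|S − T| ≤ (2a + d) T`. [cite: FordGreenKonyaginMaynardTao2018, §8 p. 23 (proof of (6.3))] -/
theorem abs_sub_le_chain₂ {S M T m a d : ℝ} (hT : 0 ≤ T) (hM : M = m * T) (hm : |m - 1| ≤ d)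
    (hd1 : d ≤ 1) (hS : |S - M| ≤ a * M) (ha : 0 ≤ a) : |S - T| ≤ (2 * a + d) * T := by
  have hm' := abs_le.mp hm
  have hm0 : 0 ≤ m := by linarith
  have hm2 : m ≤ 2 := by linarith
  have hM0 : 0 ≤ M := by rw [hM]; positivity
  have hM2 : M ≤ 2 * T := by rw [hM]; nlinarith
  have hMT : |M - T| ≤ d * T := by
    rw [hM, show m * T - T = (m - 1) * T by ring, abs_mul, abs_of_nonneg hT]
    exact mul_le_mul_of_nonneg_right hm hT
  have haM : a * M ≤ 2 * a * T := by nlinarith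
  calc |S - T| = |(S - M) + (M - T)| := by ring_nf
    _ ≤ |S - M| + |M - T| := abs_add_le _ _
    _ ≤ a * M + d * T := add_le_add hS hMT
    _ ≤ (2 * a + d) * T := by linarith

/-- `a, b ∈ [1, 1 + η]`, `η ≤ 1` ⟹ `|(a/b)² − 1| ≤ 3η` (the ratio of two correction factors).
[cite: FordGreenKonyaginMaynardTao2018, §8 proof of (6.4) («(1 + O(k/x))»)] -/
theorem abs_div_sq_sub_one_le {a b η : ℝ} (ha1 : 1 ≤ a) (ha2 : a ≤ 1 + η) (hb1 : 1 ≤ b)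
    (hb2 : b ≤ 1 + η) (hη1 : η ≤ 1) : |(a / b) ^ 2 - 1| ≤ 3 * η := by
  have hb0 : 0 < b := by linarith
  have hη0 : 0 ≤ η := by linarith
  have hbb : b ^ 2 ≤ (1 + η) ^ 2 := by nlinarith
  have haa : a ^ 2 ≤ (1 + η) ^ 2 := by nlinarith
  have ha1' : 1 ≤ a ^ 2 := by nlinarith
  have hb1' : 1 ≤ b ^ 2 := by nlinarith
  rw [div_pow, abs_le]
  constructor
  · rw [le_sub_iff_add_le, le_div_iff₀ (by positivity)]
    by_cases h3 : 3 * η ≤ 1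
    · nlinarith [mul_le_mul_of_nonneg_left hbb (by linarith : (0 : ℝ) ≤ 1 - 3 * η)]
    · nlinarith
  · rw [sub_le_iff_le_add, div_le_iff₀ (by positivity)]
    nlinarith

/-- For `X ≥ x/2` and `log x ≥ 2`: `1/log^{1/10} X ≤ 2/log^{1/10} x` (so Theorem 6's relative error
`K/log^{1/10} X` is `≤ 2K/log^{1/10} x` at all scales `X ∈ [x/2, x log² x]`).
[cite: FordGreenKonyaginMaynardTao2018, §8 p. 23 («x/2 < X ≤ x log² x»)] -/
theorem inv_log_rpow_le {x X : ℝ} (hx : 0 < x) (hL : 2 ≤ Real.log x) (hX : x / 2 ≤ X) :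
    1 / Real.log X ^ ((1 : ℝ) / 10) ≤ 2 / Real.log x ^ ((1 : ℝ) / 10) := by
  have hlog2 : Real.log 2 < 1 := by have := Real.log_two_lt_d9; linarith
  have hX0 : 0 < X := by linarith
  have hLX : Real.log x / 2 ≤ Real.log X := by
    have h1 : Real.log (x / 2) ≤ Real.log X := Real.log_le_log (by positivity) hX
    rw [Real.log_div hx.ne' two_ne_zero] at h1
    linarith
  have hL0 : 0 < Real.log x := by linarith
  have hhalf : (1 / 2 : ℝ) ≤ (1 / 2 : ℝ) ^ ((1 : ℝ) / 10) := by
    have := Real.rpow_le_rpow_of_exponent_ge (show (0 : ℝ) < 1 / 2 by norm_num)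
      (show (1 / 2 : ℝ) ≤ 1 by norm_num) (show (1 : ℝ) / 10 ≤ 1 by norm_num)
    rwa [Real.rpow_one] at this
  have h2 : Real.log x ^ ((1 : ℝ) / 10) / 2 ≤ Real.log X ^ ((1 : ℝ) / 10) := by
    have h3 : (Real.log x / 2) ^ ((1 : ℝ) / 10) ≤ Real.log X ^ ((1 : ℝ) / 10) :=
      Real.rpow_le_rpow (by positivity) hLX (by norm_num)
    have h4 : (Real.log x / 2) ^ ((1 : ℝ) / 10) =
        Real.log x ^ ((1 : ℝ) / 10) * (1 / 2 : ℝ) ^ ((1 : ℝ) / 10) := by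
      rw [div_eq_mul_one_div, Real.mul_rpow hL0.le (by norm_num)]
    rw [h4] at h3
    have h5 : 0 ≤ Real.log x ^ ((1 : ℝ) / 10) := Real.rpow_nonneg hL0.le _
    nlinarith [mul_le_mul_of_nonneg_left hhalf h5]
  have h6 : 0 < Real.log x ^ ((1 : ℝ) / 10) := Real.rpow_pos_of_pos hL0 _
  rw [div_le_div_iff₀ (by linarith) h6]
  linarith

/-! ### The dyadic blocks `𝒜(X)` -/

/-- `n ∈ 𝒜(X) ⟺ X ≤ n ≤ 2X`. [cite: FordGreenKonyaginMaynardTao2018, §7 p. 20 (definition of 𝒜(X))] -/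
theorem mem_dyadZ {X : ℝ} {n : ℤ} : n ∈ dyadZ X ↔ X ≤ n ∧ (n : ℝ) ≤ 2 * X := by
  rw [dyadZ, Finset.mem_Icc, Int.ceil_le, Int.le_floor]

/-- `X − 1 ≤ #𝒜(X) ≤ X + 1` for `X ≥ 0`. [cite: FordGreenKonyaginMaynardTao2018, §7 p. 20] -/
theorem card_dyadZ_bounds {X : ℝ} (hX : 0 ≤ X) :
    X - 1 ≤ (#(dyadZ X) : ℝ) ∧ (#(dyadZ X) : ℝ) ≤ X + 1 := by
  have hc : ⌈X⌉ ≤ ⌊2 * X⌋ + 1 := by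
    have h1 : ⌈X⌉ ≤ ⌊X⌋ + 1 := Int.ceil_le_floor_add_one X
    have h2 : ⌊X⌋ ≤ ⌊2 * X⌋ := Int.floor_le_floor (by linarith)
    omega
  have hcard : ((#(dyadZ X) : ℕ) : ℤ) = ⌊2 * X⌋ + 1 - ⌈X⌉ := by
    rw [dyadZ]
    exact Int.card_Icc_of_le _ _ hc
  have hR : (#(dyadZ X) : ℝ) = ((⌊2 * X⌋ : ℤ) : ℝ) + 1 - ((⌈X⌉ : ℤ) : ℝ) := by
    have := congrArg (fun z : ℤ => (z : ℝ)) hcard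
    push_cast at this
    exact this
  rw [hR]
  have := Int.lt_floor_add_one (2 * X)
  have := Int.ceil_lt_add_one X
  have := Int.floor_le (2 * X)
  have := Int.le_ceil X
  constructor <;> linarith

/-- `𝒜(2N) = [2N, 4N] ∩ ℤ` for a natural number `N`. [cite: FordGreenKonyaginMaynardTao2018, §8 proof of (6.3)] -/
theorem dyadZ_two_mul_natCast (N : ℕ) : dyadZ (2 * (N : ℝ)) = Finset.Icc (2 * (N : ℤ)) (4 * N) := by
  rw [dyadZ]
  congr 1
  · rw [show (2 * (N : ℝ)) = ((2 * (N : ℤ) : ℤ) : ℝ) by push_cast; ring, Int.ceil_intCast]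
  · rw [show 2 * (2 * (N : ℝ)) = ((4 * (N : ℤ) : ℤ) : ℝ) by push_cast; ring, Int.floor_intCast]

/-- Translating a window sum: `∑_{n ∈ [a,b]} w_𝓛(n) = ∑_{m ∈ [a+c, b+c]} w_{𝓛'}(m)` with the
translated family `𝓛' = shiftForms 𝓛 c`. [cite: FordGreenKonyaginMaynardTao2018, §8 («by translation»)] -/
theorem sum_Icc_sieveWt_eq_sum_shift (L : Fin k → ℤ × ℤ) (B : ℕ) (R : ℝ) (F : (Fin k → ℝ) → ℝ)
    (a b c : ℤ) :
    ∑ n ∈ Finset.Icc a b, sieveWt L B R F n =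
      ∑ m ∈ Finset.Icc (a + c) (b + c), sieveWt (shiftForms L c) B R F m := by
  rw [← Finset.map_add_right_Icc, Finset.sum_map]
  refine Finset.sum_congr rfl fun n _ => ?_
  rw [addRightEmbedding_apply, sieveWt_shiftForms]

/-- The positive primes of `𝒜(x/2 + 1/4) = (x/2, x] ∩ ℤ` are exactly (the images of) the primes of
`𝒫 = {x/2 < p ≤ x}`. [cite: FordGreenKonyaginMaynardTao2018, §8 proof of (6.4) («primes in (x/2, x]»)] -/
theorem dyadZ_filter_prime_eq_map (x : ℕ) :
    (dyadZ ((x : ℝ) / 2 + 1 / 4)).filter (fun n : ℤ => 0 < n ∧ n.natAbs.Prime) =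
      (primesHalf x).map Nat.castEmbedding := by
  ext n
  rw [Finset.mem_filter, mem_dyadZ, Finset.mem_map]
  constructor
  · rintro ⟨⟨h1, h2⟩, hn0, hpr⟩
    have hn : ((n.natAbs : ℕ) : ℤ) = n := Int.natAbs_of_nonneg hn0.le
    have hnR : ((n.natAbs : ℕ) : ℝ) = (n : ℝ) := by
      rw [Nat.cast_natAbs, abs_of_pos hn0]
    refine ⟨n.natAbs, ?_, ?_⟩
    · unfold primesHalf
      rw [Finset.mem_filter, Finset.mem_Icc]
      refine ⟨⟨hpr.one_le, ?_⟩, hpr, ?_⟩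
      · have h' : ((n.natAbs : ℕ) : ℝ) < ((x + 1 : ℕ) : ℝ) := by
          push_cast; rw [hnR]; linarith
        have := Nat.cast_lt.mp h'
        omega
      · have h' : ((x : ℕ) : ℝ) < ((2 * n.natAbs : ℕ) : ℝ) := by
          push_cast; rw [hnR]; linarith
        exact Nat.cast_lt.mp h'
    · rw [Nat.castEmbedding_apply, hn]
  · rintro ⟨p, hp, rfl⟩
    unfold primesHalf at hp
    rw [Finset.mem_filter, Finset.mem_Icc] at hp
    obtain ⟨⟨-, hpx⟩, hpr, h2p⟩ := hp
    rw [Nat.castEmbedding_apply]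
    have hpx' : (p : ℝ) ≤ x := by exact_mod_cast hpx
    have h2p' : ((x : ℕ) : ℝ) + 1 ≤ ((2 * p : ℕ) : ℝ) := by exact_mod_cast h2p
    push_cast at h2p'
    refine ⟨⟨?_, ?_⟩, by exact_mod_cast hpr.pos, by rw [Int.natAbs_natCast]; exact hpr⟩
    · rw [Int.cast_natCast]; linarith
    · rw [Int.cast_natCast]; linarith

/-- Sums over the primes of `𝒜(x/2 + 1/4)` are sums over `𝒫`. [cite: FordGreenKonyaginMaynardTao2018, §8 proof of (6.4)] -/
theorem sum_dyadZ_filter_prime_eq (x : ℕ) (f : ℤ → ℝ) :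
    ∑ n ∈ (dyadZ ((x : ℝ) / 2 + 1 / 4)).filter (fun n : ℤ => 0 < n ∧ n.natAbs.Prime), f n =
      ∑ p ∈ primesHalf x, f p := by
  rw [dyadZ_filter_prime_eq_map, Finset.sum_map]
  rfl

/-- `#𝒫_{n ↦ n}(x/2 + 1/4) = #𝒫`. [cite: FordGreenKonyaginMaynardTao2018, §8 proof of (6.4)] -/
theorem card_dyadZ_filter_prime_eq (x : ℕ) :
    #((dyadZ ((x : ℝ) / 2 + 1 / 4)).filter (fun n : ℤ => 0 < n ∧ n.natAbs.Prime)) =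
      #(primesHalf x) := by
  rw [dyadZ_filter_prime_eq_map, Finset.card_map]

/-! ### The prime number theorem for `#𝒫` -/

/-- The primes of `(⌊x/2⌋, x]` are `𝒫`. [cite: FordGreenKonyaginMaynardTao2018, (3.4)] -/
theorem Ioc_filter_prime_eq_primesHalf (x : ℕ) :
    (Finset.Ioc ⌊(x : ℝ) / 2⌋₊ ⌊(x : ℝ)⌋₊).filter Nat.Prime = primesHalf x := by
  ext p
  rw [Nat.floor_natCast]
  unfold primesHalf
  simp only [Finset.mem_filter, Finset.mem_Ioc, Finset.mem_Icc]
  constructor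
  · rintro ⟨⟨h1, h2⟩, hp⟩
    refine ⟨⟨hp.one_le, h2⟩, hp, ?_⟩
    rw [Nat.floor_lt (by positivity)] at h1
    have : ((x : ℕ) : ℝ) < ((2 * p : ℕ) : ℝ) := by push_cast; linarith
    exact Nat.cast_lt.mp this
  · rintro ⟨⟨-, h2⟩, hp, h3⟩
    refine ⟨⟨?_, h2⟩, hp⟩
    rw [Nat.floor_lt (by positivity)]
    have : ((x : ℕ) : ℝ) < ((2 * p : ℕ) : ℝ) := by exact_mod_cast h3
    push_cast at this
    linarith

/-- `∑_{p ∈ 𝒫} log p = ϑ(x) − ϑ(x/2)`. [cite: MontgomeryVaughan2007, §2.2 (definition of ϑ)] -/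
theorem sum_primesHalf_log_eq (x : ℕ) :
    ∑ p ∈ primesHalf x, Real.log p = Chebyshev.theta x - Chebyshev.theta ((x : ℝ) / 2) := by
  have hx : (x : ℝ) / 2 ≤ x := by
    have : (0 : ℝ) ≤ x := Nat.cast_nonneg x
    linarith
  rw [Maynard2016.theta_sub_theta_eq hx, Ioc_filter_prime_eq_primesHalf]

/-- **`#𝒫 = (1 + O(1/log x)) · x/(2 log x)`**: there is `A ≥ 0` with
`|#𝒫 − x/(2 log x)| ≤ (A/log x) · x/(2 log x)` for all large `x` (from `ϑ(x) = x + O(x/log² x)`,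
PROVED in the tree). [cite: MontgomeryVaughan2007, Theorem 6.9 (6.13) (consequence for π(x) − π(x/2))] -/
theorem card_primesHalf_asymp : ∃ A : ℝ, 0 ≤ A ∧ ∀ᶠ x : ℕ in atTop,
    |(#(primesHalf x) : ℝ) - x / (2 * Real.log x)| ≤ A / Real.log x * (x / (2 * Real.log x)) := by
  obtain ⟨C, hC0, hC⟩ :=
    Literature.NumberTheory.LFunctions.Mertens.exists_abs_theta_sub_le_div_log_pow 2
  refine ⟨2 + 15 * C, by positivity, ?_⟩
  have hℓ : Tendsto (fun x : ℕ => Real.log x) atTop atTop :=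
    Real.tendsto_log_atTop.comp tendsto_natCast_atTop_atTop
  filter_upwards [eventually_ge_atTop 4, hℓ.eventually_ge_atTop 2] with x hx4 hL2
  set L := Real.log x with hLdef
  set P : ℝ := (#(primesHalf x) : ℝ) with hPdef
  set D : ℝ := ∑ p ∈ primesHalf x, Real.log p with hDdef
  have hx0 : (0 : ℝ) < x := by exact_mod_cast (by omega : 0 < x)
  have hx4' : (4 : ℝ) ≤ x := by exact_mod_cast hx4
  have hlog2 : Real.log 2 < 0.7 := by have := Real.log_two_lt_d9; linarith
  have hlog2' : 0 < Real.log 2 := Real.log_pos one_lt_two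
  have hL0 : 0 < L := by linarith
  have hLh : Real.log ((x : ℝ) / 2) = L - Real.log 2 := by
    rw [Real.log_div hx0.ne' two_ne_zero]
  have hP0 : 0 ≤ P := by positivity
  have hD0 : 0 ≤ D := Finset.sum_nonneg fun p hp =>
    Real.log_nonneg (by exact_mod_cast (prime_of_mem_primesHalf hp).1.one_le)
  -- ϑ-input
  set e₁ : ℝ := C * x / L ^ 2 with he₁
  have he₁0 : 0 ≤ e₁ := by positivity
  have hCx : 0 ≤ C * x := mul_nonneg hC0 hx0.le
  have he₁L : e₁ * L ≤ C * x / 2 := by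
    have : e₁ * L = C * x / L := by
      rw [he₁, pow_two, ← div_div, div_mul_cancel₀ _ hL0.ne']
    rw [this]
    exact div_le_div_of_nonneg_left hCx two_pos hL2
  have he₁' : e₁ ≤ C * x / 4 := by
    rw [he₁]
    exact div_le_div_of_nonneg_left hCx (by norm_num) (by nlinarith)
  have hθ1 : |Chebyshev.theta x - x| ≤ e₁ := hC x (by linarith)
  have hθ2 : |Chebyshev.theta ((x : ℝ) / 2) - x / 2| ≤ 2 * e₁ := by
    have h := hC ((x : ℝ) / 2) (by linarith)
    rw [hLh] at h
    refine h.trans ?_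
    have hden : L ^ 2 / 4 ≤ (L - Real.log 2) ^ 2 := by nlinarith
    have hden0 : 0 < L ^ 2 / 4 := by positivity
    calc C * ((x : ℝ) / 2) / (L - Real.log 2) ^ 2 ≤ C * ((x : ℝ) / 2) / (L ^ 2 / 4) :=
          div_le_div_of_nonneg_left (by positivity) hden0 hden
      _ = 2 * e₁ := by rw [he₁]; field_simp; ring
  have hDx : |D - x / 2| ≤ 3 * e₁ := by
    rw [hDdef, sum_primesHalf_log_eq]
    calc |Chebyshev.theta x - Chebyshev.theta ((x : ℝ) / 2) - x / 2|
        = |(Chebyshev.theta x - x) - (Chebyshev.theta ((x : ℝ) / 2) - x / 2)| := by ring_nf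
      _ ≤ |Chebyshev.theta x - x| + |Chebyshev.theta ((x : ℝ) / 2) - x / 2| := abs_sub _ _
      _ ≤ e₁ + 2 * e₁ := add_le_add hθ1 hθ2
      _ = 3 * e₁ := by ring
  -- the sum against the count
  have hlow : P * (L - Real.log 2) ≤ D := by
    rw [← hLh]
    have h := Finset.card_nsmul_le_sum (primesHalf x) (fun p : ℕ => Real.log p)
      (Real.log ((x : ℝ) / 2)) fun p hp => by
        obtain ⟨hpr, h2p⟩ := prime_of_mem_primesHalf hp
        apply Real.log_le_log (by positivity)
        have : (x : ℝ) < 2 * p := by exact_mod_cast h2p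
        linarith
    rw [nsmul_eq_mul] at h
    exact h
  have hupp : D ≤ P * L := by
    have h := Finset.sum_le_card_nsmul (primesHalf x) (fun p : ℕ => Real.log p) L fun p hp => by
      have h1 := le_of_mem_primesHalf hp
      have hpr := (prime_of_mem_primesHalf hp).1
      exact Real.log_le_log (by exact_mod_cast hpr.pos) (by exact_mod_cast h1)
    rw [nsmul_eq_mul] at h
    linarith
  -- Q = P L²
  have hDle := (abs_le.mp hDx).2
  have hDge := (abs_le.mp hDx).1
  have hQlo : x * L / 2 - (1 + 15 / 2 * C) * x ≤ P * L ^ 2 := by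
    have h1 : D * L ≤ P * L * L := mul_le_mul_of_nonneg_right hupp hL0.le
    have h2 : (x / 2 - 3 * e₁) * L ≤ D * L := mul_le_mul_of_nonneg_right (by linarith) hL0.le
    have h3 : (x / 2 - 3 * e₁) * L = x * L / 2 - 3 * (e₁ * L) := by ring
    have h4 : P * L * L = P * L ^ 2 := by ring
    linarith
  have hQhi : P * L ^ 2 ≤ x * L / 2 + (1 + 15 / 2 * C) * x := by
    have hhalf : L / 2 ≤ L - Real.log 2 := by linarith
    have h1' : P * (L - Real.log 2) * L ≤ D * L := mul_le_mul_of_nonneg_right hlow hL0.le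
    have h1'' : P * L * (L / 2) ≤ P * L * (L - Real.log 2) :=
      mul_le_mul_of_nonneg_left hhalf (mul_nonneg hP0 hL0.le)
    have e3 : P * L * (L - Real.log 2) = P * (L - Real.log 2) * L := by ring
    have hPL : P * L ≤ 2 * D := by
      refine le_of_mul_le_mul_right ?_ hL0
      have e4 : P * L * (L / 2) * 2 = P * L * L := by ring
      linarith
    have h2 : P * L ^ 2 ≤ D * L + Real.log 2 * (P * L) := by
      have e5 : P * L ^ 2 = P * (L - Real.log 2) * L + Real.log 2 * (P * L) := by ring
      linarith
    have h25 : Real.log 2 * (P * L) ≤ 0.7 * (2 * D) :=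
      mul_le_mul hlog2.le hPL (mul_nonneg hP0 hL0.le) (by norm_num)
    have h4 : D * (L + 1.4) ≤ (x / 2 + 3 * e₁) * (L + 1.4) :=
      mul_le_mul_of_nonneg_right (by linarith) (by linarith)
    have e6 : D * (L + 1.4) = D * L + 1.4 * D := by ring
    have e7 : (x / 2 + 3 * e₁) * (L + 1.4) = x * L / 2 + 0.7 * x + 3 * (e₁ * L) + 4.2 * e₁ := by
      ring
    linarith
  have e1 : P - x / (2 * L) = (P * L ^ 2 - x * L / 2) / L ^ 2 := by
    field_simp
  have e2 : (2 + 15 * C) / L * (x / (2 * L)) = ((1 + 15 / 2 * C) * x) / L ^ 2 := by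
    field_simp
  rw [e1, e2, abs_div, abs_of_pos (by positivity : (0 : ℝ) < L ^ 2)]
  exact div_le_div_of_nonneg_right (abs_le.mpr ⟨by linarith, by linarith⟩) (by positivity)

/-! ### `Δ/φ(Δ) ≪ log log Δ` -/

/-- **`n/φ(n) ≤ 3 log log n`** for all large `n` (Landau's extremal order of `φ`, with the
constant `3 > e^γ`); used for the factor `Δ_L/φ(Δ_L)` of (7.14) in the proof of (6.5).
[cite: HardyWright2008, Theorem 328; FordGreenKonyaginMaynardTao2018, §8 proof of (6.5) («Δ_L/φ(Δ_L) ≪ log₂ x»)] -/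
theorem self_div_totient_le_three_mul_loglog :
    ∀ᶠ n : ℕ in atTop, (n : ℝ) / Nat.totient n ≤ 3 * Real.log (Real.log n) := by
  have hc : (1 : ℝ) / 3 < Real.exp (-Real.eulerMascheroniConstant) := by
    have h1 := Real.add_one_le_exp (-(2 : ℝ) / 3)
    have h2 : Real.exp (-(2 : ℝ) / 3) < Real.exp (-Real.eulerMascheroniConstant) :=
      Real.exp_lt_exp.mpr (by have := Real.eulerMascheroniConstant_lt_two_thirds; linarith)
    linarith
  filter_upwards [Literature.NumberTheory.Multiplicative.ExtremalOrder.eventually_le_totient_mul_loglog_div hc,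
    eventually_ge_atTop 1] with n hn hn1
  have hn0 : (0 : ℝ) < n := by exact_mod_cast hn1
  have hφ0 : (0 : ℝ) < Nat.totient n := by exact_mod_cast Nat.totient_pos.mpr hn1
  rw [le_div_iff₀ hn0] at hn
  rw [div_le_iff₀ hφ0]
  linarith

/-! ### Primes `> 2k²` and the cut-off `W` -/

/-- `W > 0`. [cite: FordGreenKonyaginMaynardTao2018, §7 p. 21] -/
theorem wCut_pos (k B : ℕ) : 0 < wCut k B :=
  Finset.prod_pos fun _ hp => (Finset.mem_filter.mp hp).2.1.pos

/-- A prime `s > 2k²` does not divide `W = ∏_{p ≤ 2k², p ∤ B} p`. [cite: FordGreenKonyaginMaynardTao2018, §7 p. 21] -/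
theorem not_dvd_wCut_of_lt {B s : ℕ} (hs : s.Prime) (hks : 2 * k ^ 2 < s) : ¬ s ∣ wCut k B := by
  intro h
  unfold wCut at h
  obtain ⟨p, hp, hsp⟩ := (Nat.Prime.prime hs).exists_mem_finset_dvd h
  rw [Finset.mem_filter, Finset.mem_range] at hp
  have := (Nat.prime_dvd_prime_iff_eq hs hp.2.1).mp hsp
  omega

/-- `(s, W) = 1` for a prime `s > 2k²` — the cut-off condition of `w` at a prime value of a form.
[cite: FordGreenKonyaginMaynardTao2018, §8 proof of (6.4)] -/
theorem int_gcd_wCut_eq_one {B s : ℕ} (hs : s.Prime) (hks : 2 * k ^ 2 < s) :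
    Int.gcd (s : ℤ) (wCut k B) = 1 := by
  rw [Int.gcd_natCast_natCast]
  exact (Nat.Prime.coprime_iff_not_dvd hs).mpr (not_dvd_wCut_of_lt hs hks)

/-- A prime `s > 2k²` with `s ∤ B` does not divide `WB`. [cite: FordGreenKonyaginMaynardTao2018, §8] -/
theorem not_dvd_wCut_mul {B s : ℕ} (hs : s.Prime) (hks : 2 * k ^ 2 < s) (hsB : ¬ s ∣ B) :
    ¬ s ∣ wCut k B * B := fun h => (hs.dvd_mul.mp h).elim (not_dvd_wCut_of_lt hs hks) hsB

/-- A natural number `d < P` divides the prime `P` iff `d = 1`. [cite: FordGreenKonyaginMaynardTao2018, §8 proof of (6.4) («d ≤ R < p»)] -/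
theorem natCast_dvd_prime_iff {d P : ℕ} (hP : P.Prime) (hdP : d < P) : (d : ℤ) ∣ (P : ℤ) ↔ d = 1 := by
  rw [Int.natCast_dvd_natCast, Nat.dvd_prime hP]
  omega

/-! ### The increasing enumeration of `H` -/

/-- Every element of `H` is enumerated. [cite: FordGreenKonyaginMaynardTao2018, §6] -/
theorem tupleEnum_surj (H : Finset ℤ) (hk : H.card = k) {h₀ : ℤ} (hh₀ : h₀ ∈ H) :
    ∃ i, tupleEnum H hk i = h₀ := by
  have : h₀ ∈ Set.range (H.orderEmbOfFin hk) := by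
    rw [Finset.range_orderEmbOfFin]
    exact hh₀
  exact this

/-- The size hypothesis of Theorem 5 along the enumeration: `1 ≤ h_i ≤ 2k²`. [cite: FordGreenKonyaginMaynardTao2018, Theorem 5] -/
theorem tupleEnum_bounds (H : Finset ℤ) (hk : H.card = k)
    (hH : ∀ h ∈ H, 1 ≤ h ∧ h ≤ 2 * (#H : ℤ) ^ 2) (i : Fin k) :
    1 ≤ tupleEnum H hk i ∧ tupleEnum H hk i ≤ 2 * (k : ℤ) ^ 2 := by
  have := hH _ (tupleEnum_mem H hk i)
  rw [hk] at this
  exact this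

/-! ### The correction factors `𝔖_D(𝓛_p)/𝔖_D(𝓛_1)`, `𝔖_D(L̃_{q,i})/𝔖_D(𝓛_1)` -/

/-- **`𝔖_D(𝓛_p) = ρ · 𝔖_D(𝓛_1)` with `1 ≤ ρ ≤ 1 + 2k/p`** for a prime `p > 2k²` and an admissible
`H ⊂ [1, 2k²]` (`ρ = 1` if `p ∣ D`). [cite: FordGreenKonyaginMaynardTao2018, §8 proof of (6.3) («𝔖(𝓛_p) = (1 + O(k/p)) 𝔖»)] -/
theorem singSeriesExcl_tupleForms_ratio {H : Finset ℤ} (hH : IsAdmissibleTuple H) (hk : H.card = k)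
    (hk1 : 1 ≤ k) (hb : ∀ i, 1 ≤ tupleEnum H hk i ∧ tupleEnum H hk i ≤ 2 * (k : ℤ) ^ 2)
    {p D : ℕ} (hp : p.Prime) (hkp : 2 * k ^ 2 < p) (hD : D ≠ 0) :
    ∃ ρ : ℝ, 1 ≤ ρ ∧ ρ ≤ 1 + 2 * (k : ℝ) / p ∧
      singSeriesExcl (tupleForms (tupleEnum H hk) p) D =
        ρ * singSeriesExcl (tupleForms (tupleEnum H hk) 1) D := by
  have hρ0 : (0 : ℝ) ≤ 2 * (k : ℝ) / p := by positivity
  by_cases hpD : p ∣ D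
  · exact ⟨1, le_rfl, by linarith, by rw [singSeriesExcl_tupleForms_of_dvd _ hp hpD, one_mul]⟩
  have hinc := tuple_incongruent_of_bounds _ (tupleEnum_injective H hk) hb p hp hkp
  have h1 : omegaL (tupleForms (tupleEnum H hk) p) p = 1 := omegaL_tupleForms_self _ hp (by omega)
  have h2 : omegaL (tupleForms (tupleEnum H hk) 1) p = k := by
    rw [omegaL_tupleForms _ hp (Nat.Prime.not_dvd_one hp)]
    exact tupleCount_eq_of_incongruent _ hinc
  have hkk : k ≤ 2 * k ^ 2 := by nlinarith
  have hkp' : k < p := by omega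
  have h2kp : 2 * k ≤ p := by nlinarith
  refine ⟨_, ?_, ?_, singSeriesExcl_tupleForms hH hk hp hpD hD⟩
  · rw [singFactor_div_singFactor_eq hp h1 h2 hkp']
    exact (one_le_corr_le hk1 h2kp).1
  · rw [singFactor_div_singFactor_eq hp h1 h2 hkp']
    exact (one_le_corr_le hk1 h2kp).2

/-- **`𝔖_D(L̃_{q,i₀}) = ρ · 𝔖_D(𝓛_1)` with `1 ≤ ρ ≤ 1 + 2k/q`** for a prime `q > 2k²`, `q ∤ D`.
[cite: FordGreenKonyaginMaynardTao2018, §8 proof of (6.4) («𝔖(L̃_{q,i}) = (1 + O(k/x)) 𝔖»)] -/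
theorem singSeriesExcl_wbpForms_ratio {H : Finset ℤ} (hH : IsAdmissibleTuple H) (hk : H.card = k)
    (hk1 : 1 ≤ k) (hb : ∀ i, 1 ≤ tupleEnum H hk i ∧ tupleEnum H hk i ≤ 2 * (k : ℤ) ^ 2)
    {q D : ℕ} (hq : q.Prime) (hkq : 2 * k ^ 2 < q) (hqD : ¬ q ∣ D) (hD : D ≠ 0) (i₀ : Fin k) :
    ∃ ρ : ℝ, 1 ≤ ρ ∧ ρ ≤ 1 + 2 * (k : ℝ) / q ∧
      singSeriesExcl (wbpForms (tupleEnum H hk) q i₀) D =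
        ρ * singSeriesExcl (tupleForms (tupleEnum H hk) 1) D := by
  have hinc := tuple_incongruent_of_bounds _ (tupleEnum_injective H hk) hb q hq hkq
  have hh : ∀ j : Fin k, j ≠ i₀ → ¬ (q : ℤ) ∣ tupleEnum H hk j - tupleEnum H hk i₀ :=
    fun j hj => hinc j i₀ hj
  have h1 : omegaL (wbpForms (tupleEnum H hk) q i₀) q = 1 := omegaL_wbpForms_self _ hq i₀ hh
  have h2 : omegaL (tupleForms (tupleEnum H hk) 1) q = k := by
    rw [omegaL_tupleForms _ hq (Nat.Prime.not_dvd_one hq)]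
    exact tupleCount_eq_of_incongruent _ hinc
  have hkk : k ≤ 2 * k ^ 2 := by nlinarith
  have hkq' : k < q := by omega
  have h2kq : 2 * k ≤ q := by nlinarith
  refine ⟨_, ?_, ?_, singSeriesExcl_wbpForms hH hk hq i₀ hqD hD⟩
  · rw [singFactor_div_singFactor_eq hq h1 h2 hkq']
    exact (one_le_corr_le hk1 h2kq).1
  · rw [singFactor_div_singFactor_eq hq h1 h2 hkq']
    exact (one_le_corr_le hk1 h2kq).2

/-! ### The comparison principle of the proof of (6.4) -/

/-- **`w_{𝓛_p}(q − h_{i₀} p) = (𝔖_{WB}(𝓛_p)/𝔖_{WB}(L̃_{q,i₀}))² · w_{L̃_{q,i₀}}(p)`** for primes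
`p, q > max(R, 2k²)`, `q ∤ B`: the two families have the same `𝒟_k ∩ {d ≤ R}` and the same `φ_ω`
on it, their form values at the two arguments agree for `j ≠ i₀` and are the primes `q`, `p` at
`j = i₀` (both coprime to `W` and divisible by no `1 < d ≤ R`).
[cite: FordGreenKonyaginMaynardTao2018, §8 proof of (6.4) («w(p, q − h_i p) = (1 + O(k/x)) w̃_{L̃_{q,i}}(p)»)] -/
theorem sieveWt_tupleForms_eq_sq_mul {H : Finset ℤ} (hH : IsAdmissibleTuple H) (hk : H.card = k)
    (hk1 : 1 ≤ k) (hb : ∀ i, 1 ≤ tupleEnum H hk i ∧ tupleEnum H hk i ≤ 2 * (k : ℤ) ^ 2)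
    (F : (Fin k → ℝ) → ℝ) {B p q : ℕ} {R : ℝ} (hB : B ≠ 0) (hp : p.Prime) (hq : q.Prime)
    (hkp : 2 * k ^ 2 < p) (hkq : 2 * k ^ 2 < q) (hRp : ⌊R⌋₊ < p) (hRq : ⌊R⌋₊ < q) (hqB : ¬ q ∣ B)
    (i₀ : Fin k) :
    sieveWt (tupleForms (tupleEnum H hk) p) B R F ((q : ℤ) - tupleEnum H hk i₀ * p) =
      (singSeriesExcl (tupleForms (tupleEnum H hk) p) (wCut k B * B) /
          singSeriesExcl (wbpForms (tupleEnum H hk) q i₀) (wCut k B * B)) ^ 2 *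
        sieveWt (wbpForms (tupleEnum H hk) q i₀) B R F p := by
  have hinc := tuple_incongruent_of_bounds _ (tupleEnum_injective H hk) hb
  have hDp : dkBox (tupleForms (tupleEnum H hk) p) B R = dkBoxCoprime k B R :=
    dkBox_tupleForms _ hp hRp hinc
  have hD : dkBox (tupleForms (tupleEnum H hk) p) B R = dkBox (wbpForms (tupleEnum H hk) q i₀) B R := by
    rw [hDp, dkBox_wbpForms _ hq i₀ hRq hinc]
  have hφ : ∀ r ∈ dkBox (tupleForms (tupleEnum H hk) p) B R,
      phiOmega (tupleForms (tupleEnum H hk) p) (∏ i, r i) =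
        phiOmega (wbpForms (tupleEnum H hk) q i₀) (∏ i, r i) := by
    intro r hr
    rw [hDp] at hr
    rw [phiOmega_tupleForms_of_mem _ hp hRp hr, phiOmega_wbpForms _ hq i₀]
    intro s hs
    have := prime_le_of_mem_dkBoxCoprime hr hs
    omega
  have hWD : wCut k B * B ≠ 0 := mul_ne_zero (wCut_pos k B).ne' hB
  have hqWB : ¬ q ∣ wCut k B * B := not_dvd_wCut_mul hq hkq hqB
  have hpos : 0 < singSeriesExcl (wbpForms (tupleEnum H hk) q i₀) (wCut k B * B) := by
    obtain ⟨ρ, hρ1, -, hρ⟩ := singSeriesExcl_wbpForms_ratio hH hk hk1 hb hq hkq hqWB hWD i₀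
    rw [hρ]
    exact mul_pos (by linarith) (singSeriesExcl_tupleForms_one_pos hH hk hWD)
  have hcut : (∀ i, Int.gcd (formEval (tupleForms (tupleEnum H hk) p i)
        ((q : ℤ) - tupleEnum H hk i₀ * p)) (wCut k B) = 1) ↔
      ∀ i, Int.gcd (formEval (wbpForms (tupleEnum H hk) q i₀ i) p) (wCut k B) = 1 := by
    refine forall_congr' fun i => ?_
    rcases eq_or_ne i i₀ with rfl | hi
    · rw [formEval_tupleForms_sub, formEval_wbpForms_self]
      exact iff_of_true (int_gcd_wCut_eq_one hq hkq) (int_gcd_wCut_eq_one hp hkp)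
    · rw [formEval_wbpForms_eq _ q p hi]
  have hdiv : ∀ d ∈ dkBox (tupleForms (tupleEnum H hk) p) B R,
      (∀ i, ((d i : ℕ) : ℤ) ∣ formEval (tupleForms (tupleEnum H hk) p i)
          ((q : ℤ) - tupleEnum H hk i₀ * p)) ↔
        ∀ i, ((d i : ℕ) : ℤ) ∣ formEval (wbpForms (tupleEnum H hk) q i₀ i) p := by
    intro d hd
    have hd' : d ∈ Fintype.piFinset fun _ : Fin k => Finset.Icc 1 ⌊R⌋₊ :=
      (Finset.mem_filter.mp hd).1
    refine forall_congr' fun i => ?_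
    have hdi : d i ≤ ⌊R⌋₊ := (Finset.mem_Icc.mp (Fintype.mem_piFinset.mp hd' i)).2
    rcases eq_or_ne i i₀ with rfl | hi
    · rw [formEval_tupleForms_sub, formEval_wbpForms_self,
        natCast_dvd_prime_iff hq (by omega), natCast_dvd_prime_iff hp (by omega)]
    · rw [formEval_wbpForms_eq _ q p hi]
  have key := sieveWt_mul_sq_singSeriesExcl F hD hφ hcut hdiv
  rw [div_pow, div_mul_eq_mul_div, eq_div_iff (pow_ne_zero _ hpos.ne'), key, mul_comm]

/-! ### Growth facts of the regime `x → ∞` -/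

/-- `log^[2] t = log log t`. [folklore] -/
private theorem iter_two (t : ℝ) : Real.log^[2] t = Real.log (Real.log t) := by
  simp [Function.iterate_succ_apply']

/-- `log^[3] t = log log log t`. [folklore] -/
private theorem iter_three (t : ℝ) : Real.log^[3] t = Real.log (Real.log (Real.log t)) := by
  simp [Function.iterate_succ_apply']

/-- The growth facts used in §8 (with `t = log^{1/10} x`, `ℓ₂ = log log x`): `ℓ₂ ≥ max(M, 7)`,
`ℓ₂^{11} ≤ t`, `ℓ₂ ≤ t`, `t^{10} = log x`, `log² x ≤ x`, `y ≤ x log x`, `2 t⁴ x + x ≤ y`.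
[cite: FordGreenKonyaginMaynardTao2018, §8 («for x sufficiently large», k ≤ log^{1/5} x)] -/
theorem section8_growth {c : ℝ} (hc : 0 < c) (hc1 : c ≤ 1) (M : ℝ) : ∀ᶠ x : ℕ in atTop,
    M ≤ Real.log (Real.log x) ∧ 7 ≤ Real.log (Real.log x) ∧
      Real.log (Real.log x) ^ 11 ≤ Real.log x ^ ((1 : ℝ) / 10) ∧
      Real.log (Real.log x) ≤ Real.log x ^ ((1 : ℝ) / 10) ∧
      (Real.log x ^ ((1 : ℝ) / 10)) ^ 10 = Real.log x ∧
      Real.log x ^ 2 ≤ (x : ℝ) ∧ ySieve c x ≤ x * Real.log x ∧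
      2 * (Real.log x ^ ((1 : ℝ) / 10)) ^ 4 * x + x ≤ ySieve c x := by
  have hℓ : Tendsto (fun x : ℕ => Real.log x) atTop atTop :=
    Real.tendsto_log_atTop.comp tendsto_natCast_atTop_atTop
  have hℓ₂ : Tendsto (fun x : ℕ => Real.log (Real.log x)) atTop atTop :=
    Real.tendsto_log_atTop.comp hℓ
  have hlo := (isLittleO_log_rpow_atTop (show (0 : ℝ) < 1 / 110 by norm_num)).bound
    (show (0 : ℝ) < 1 by norm_num)
  filter_upwards [hℓ₂.eventually_ge_atTop M, hℓ₂.eventually_ge_atTop 7,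
    hℓ₂.eventually_ge_atTop (3 / c), hℓ.eventually hlo, params_growth] with x hM h7 h3c hlo' hpg
  obtain ⟨hL2, -, -, -, hL2x, -⟩ := hpg
  set L := Real.log x with hLdef
  set ℓ₂ := Real.log L with hℓ₂def
  set t := L ^ ((1 : ℝ) / 10) with ht
  have hL0 : 0 < L := by linarith
  have ht0 : 0 < t := Real.rpow_pos_of_pos hL0 _
  have ht10 : t ^ 10 = L := by
    rw [ht, ← Real.rpow_natCast, ← Real.rpow_mul hL0.le]
    norm_num
  have hℓ₂t : ℓ₂ ≤ L ^ ((1 : ℝ) / 110) := by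
    have := hlo'
    rw [Real.norm_eq_abs, Real.norm_eq_abs, one_mul, abs_of_nonneg (by linarith : (0 : ℝ) ≤ ℓ₂),
      abs_of_nonneg (Real.rpow_nonneg hL0.le _)] at this
    exact this
  have h11 : ℓ₂ ^ 11 ≤ t := by
    calc ℓ₂ ^ 11 ≤ (L ^ ((1 : ℝ) / 110)) ^ 11 := pow_le_pow_left₀ (by linarith) hℓ₂t 11
      _ = t := by rw [ht, ← Real.rpow_natCast, ← Real.rpow_mul hL0.le]; norm_num
  have hℓ₂le : ℓ₂ ≤ t := by
    calc ℓ₂ = ℓ₂ ^ 1 := (pow_one _).symm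
      _ ≤ ℓ₂ ^ 11 := pow_le_pow_right₀ (by linarith) (by norm_num)
      _ ≤ t := h11
  have ht1 : 1 ≤ t := by linarith
  have hℓ₂0 : 0 < ℓ₂ := by linarith
  have hℓ₃1 : 1 ≤ Real.log ℓ₂ := by
    rw [Real.le_log_iff_exp_le hℓ₂0]
    have := Real.exp_one_lt_d9
    linarith
  have hℓ₃le : Real.log ℓ₂ ≤ ℓ₂ := Real.log_le_self hℓ₂0.le
  have hx0 : (0 : ℝ) ≤ x := Nat.cast_nonneg _
  have hy : ySieve c x = c * (x * L * Real.log ℓ₂ / ℓ₂) := by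
    rw [ySieve, iter_two, iter_three]
  refine ⟨hM, h7, h11, hℓ₂le, ht10, hL2x, ?_, ?_⟩
  · rw [hy]
    have hxL : 0 ≤ (x : ℝ) * L := mul_nonneg hx0 hL0.le
    have hA0 : 0 ≤ x * L * Real.log ℓ₂ / ℓ₂ :=
      div_nonneg (mul_nonneg hxL (by linarith)) hℓ₂0.le
    have h1 : x * L * Real.log ℓ₂ / ℓ₂ ≤ x * L := by
      rw [div_le_iff₀ hℓ₂0]
      exact mul_le_mul_of_nonneg_left hℓ₃le hxL
    nlinarith
  · rw [hy]
    have hct : 3 ≤ c * t := by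
      have : 3 / c ≤ t := h3c.trans hℓ₂le
      rw [div_le_iff₀ hc] at this
      linarith
    have step1 : c * (x * L / t) ≤ c * (x * L * Real.log ℓ₂ / ℓ₂) := by
      apply mul_le_mul_of_nonneg_left _ hc.le
      rw [div_le_div_iff₀ ht0 hℓ₂0]
      have : ℓ₂ ≤ Real.log ℓ₂ * t := by nlinarith
      calc x * L * ℓ₂ ≤ x * L * (Real.log ℓ₂ * t) :=
            mul_le_mul_of_nonneg_left this (mul_nonneg hx0 hL0.le)
        _ = x * L * Real.log ℓ₂ * t := by ring
    have step2 : c * (x * L / t) = c * t ^ 9 * x := by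
      rw [← ht10]
      field_simp
    have step3 : 2 * t ^ 4 + 1 ≤ c * t ^ 9 := by
      have h8 : t ^ 4 ≤ t ^ 8 := pow_le_pow_right₀ ht1 (by norm_num)
      have h1 : 1 ≤ t ^ 8 := one_le_pow₀ ht1
      have e : c * t ^ 9 = (c * t) * t ^ 8 := by ring
      nlinarith
    calc 2 * t ^ 4 * x + x = (2 * t ^ 4 + 1) * x := by ring
      _ ≤ c * t ^ 9 * x := mul_le_mul_of_nonneg_right step3 hx0
      _ = c * (x * L / t) := step2.symm
      _ ≤ _ := step1

end Literature.NumberTheory.Sieve.FGKMT2018
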